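import Mathlib
import HarnessLib
import Literature.NumberTheory.LFunctions.HorocycleEquidistribution
import Literature.NumberTheory.LFunctions.HorocycleStripFourier
import Literature.NumberTheory.LFunctions.HorocyclePhase
import Literature.NumberTheory.LFunctions.HorocycleZeroKernel
import Literature.NumberTheory.LFunctions.HorocycleUnfolding
import Literature.NumberTheory.LFunctions.HorocycleRHIncompleteEisenstein
import Literature.NumberTheory.LFunctions.HorocycleZeroMode
import Literature.NumberTheory.LFunctions.CoprimeResidueSums

/-!
# Proof of the unconditional rate `O(y^{1/2})` for closed horocycles on `SL(2,ℤ)\ℍ`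

Discharge of the named fact `Literature.NumberTheory.LFunctions.zagier_sarnak_horocycle_rate_half`
(`HorocycleEquidistribution.lean`; Sarnak, Comm. Pure Appl. Math. 34 (1981), Thm. 1: the rate
`T^{-1/2}` for closed horocycles of length `T = 1/y`; Zagier 1981, §1): for every `F : ℂ → ℂ`
smooth on `{im > 0}`, `SL(2,ℤ)`-invariant and vanishing on the standard fundamental domain
above some height, there is `c` with `∫₀¹ F(x+iy) dx - c = O(y^{1/2})` as `y → 0⁺`.

## The proof (elementary: unfolding, Ramanujan sums, Möbius; no Eisenstein-series continuation)

1. *Reduction to a strip test* (`HorocycleRateHalf.*`). With the bump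
   `ψ(t) = smoothTransition(3(t - 1/2))` (`= 0` for `t ≤ 1/2`, `= 1` for `t ≥ 5/6`) and the
   incomplete Eisenstein series `D = incEis ψ` (landed, `HorocycleRHIncompleteEisenstein.lean`;
   `D ≥ 1` on `ℍ` since on the fundamental domain `im ≥ √3/2 > 5/6`,
   `incEis_bump_ne_zero`), the function `f = F ψ(im)/D` is `C^∞` on `ℂ`, `1`-periodic and
   supported in `1/2 ≤ im z ≤ max Y 1` (`strip_contDiff`, `strip_periodic`, `strip_support`;
   `F` vanishes at every point of height `> max Y 1`, `apply_eq_zero_of_lt_im`), and its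
   incomplete Poincaré series is `F`: `∑_{(c,d)=1} f(γ_{c,d} z) = F(z)` (`tsum_summand_eq`).
2. *Unfolding* (`HorocycleUnfolding.horocycleAverage_poincare`, Iwaniec §3.4):
   `∫₀¹ F(x+iy) dx = 2∫₀¹ f(x+iy) dx + 2 ∑_{c ≤ N} y ∑_{r mod c}^* Ψ(c²y, r/c)`, and the seed term
   vanishes for `y < 1/2`.
3. *Nonzero modes* (`CoprimeResidueSums.norm_sum_coprime_sub_le` with the uniform decay
   `HorocyclePhase.exists_norm_coeffPsi_le`): `∑^*_r Ψ(c²y, r/c) = φ(c) Ψ̂₀(c²y) + O(M)`, and the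
   rows with `c²y ≥ 2` vanish identically, so the error is `≤ 16 M y √(2/y) = O(√y)`.
4. *Zero mode* (`HorocycleZeroKernel.mul_coeffPsi_zero_eq` and the landed
   `HorocycleZeroMode.zeroMode_bound`): `∑_c y φ(c) Ψ̂₀(c²y) = √y ∑_c (φ(c)/c) K(c√y)
   = (∑_d μ(d)/d²) ∫₀³ K + O(√y)`.
The constant is `c = 2 (∑_d μ(d)/d²) ∫₀³ K(l) dl` (`= (3/π) ∫_{Γ\ℍ} F dμ`, not needed here).

## References
* P. Sarnak, *Asymptotic behavior of periodic orbits of the horocycle flow and Eisenstein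
  series*, Comm. Pure Appl. Math. 34 (1981), 719–739, Thm. 1 [Sarnak1981].
* D. Zagier, *Eisenstein series and the Riemann zeta function*, in: Automorphic forms,
  representation theory and arithmetic (Bombay 1979), Springer 1981, 275–301, §1 [Zagier1981].
* H. Iwaniec, *Spectral Methods of Automorphic Forms*, 2nd ed., AMS GSM 53 (2002), §3.2–§3.4
  [Iwaniec2002].
-/

noncomputable section

open Complex MeasureTheory Set Filter Topology intervalIntegral
open scoped Real ContDiff MatrixGroups UpperHalfPlane

namespace Literature.NumberTheory.LFunctions

namespace HorocycleRateHalf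

open HorocycleStripFourier HorocyclePhase HorocycleZeroKernel HorocycleUnfolding

variable {F : ℂ → ℂ} {Y : ℝ}

/-! ### The bump `ψ(t) = smoothTransition(3(t - 1/2))`: `0` below `1/2`, `1` above `5/6` -/

/-- Smoothness of the bump. [folklore] -/
theorem bump_contDiff : ContDiff ℝ ∞ (fun t : ℝ => Real.smoothTransition (3 * (t - 1 / 2))) :=
  Real.smoothTransition.contDiff.comp (by fun_prop)

/-- The bump vanishes on `(-∞, 1/2]`. [folklore] -/
theorem bump_eq_zero {t : ℝ} (ht : t ≤ 1 / 2) : Real.smoothTransition (3 * (t - 1 / 2)) = 0 :=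
  Real.smoothTransition.zero_of_nonpos (by linarith)

/-- The bump is `1` on `[5/6, ∞)`. [folklore] -/
theorem bump_eq_one {t : ℝ} (ht : 5 / 6 ≤ t) : Real.smoothTransition (3 * (t - 1 / 2)) = 1 :=
  Real.smoothTransition.one_of_one_le (by linarith)

/-- Support of the bump. [folklore] -/
theorem bump_support : ∀ t : ℝ, Real.smoothTransition (3 * (t - 1 / 2)) ≠ 0 → 1 / 2 ≤ t :=
  fun _ h => by by_contra hlt; exact h (bump_eq_zero (le_of_lt (not_le.mp hlt)))

/-! ### Consequences of invariance and cusp support for `F` -/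

/-- **Cusp vanishing everywhere**: an `SL(2,ℤ)`-invariant `F` vanishing on the fundamental domain
above height `Y` vanishes at every point of height `> max Y 1` (translate into `|re| ≤ 1/2`,
where `|z| ≥ im z > 1`). [folklore] -/
theorem apply_eq_zero_of_lt_im (hinv : ∀ (g : SL(2, ℤ)) (z : ℍ), F ↑(g • z) = F ↑z)
    (hY : ∀ z : ℍ, z ∈ ModularGroup.fd → Y < z.im → F ↑z = 0) {z : ℂ} (hz : 0 < z.im)
    (h : max Y 1 < z.im) : F z = 0 := by
  set n : ℤ := -⌊z.re + 1 / 2⌋ with hn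
  set w : ℍ := ⟨z, hz⟩ with hw
  have hre : (ModularGroup.T ^ n • w).re = z.re + n := by
    rw [UpperHalfPlane.modular_T_zpow_smul, UpperHalfPlane.vadd_re]
    simp [hw, add_comm]
  have him : (ModularGroup.T ^ n • w).im = z.im := by
    rw [UpperHalfPlane.modular_T_zpow_smul, UpperHalfPlane.vadd_im]
    rfl
  have key : F ((ModularGroup.T ^ n • w : ℍ) : ℂ) = F z := hinv _ w
  rw [← key]
  apply hY
  · constructor
    · rw [Complex.normSq_apply, UpperHalfPlane.coe_re, UpperHalfPlane.coe_im, him]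
      have : 1 < z.im := lt_of_le_of_lt (le_max_right _ _) h
      nlinarith [sq_nonneg ((ModularGroup.T ^ n • w).re)]
    · rw [hre, hn, abs_le]
      push_cast
      constructor
      · linarith [Int.floor_le (z.re + 1 / 2)]
      · linarith [Int.lt_floor_add_one (z.re + 1 / 2)]
  · rw [him]; exact lt_of_le_of_lt (le_max_left _ _) h

/-- `F(z + 1) = F(z)` on `ℍ` (invariance under `T`). [folklore] -/
theorem apply_add_one (hinv : ∀ (g : SL(2, ℤ)) (z : ℍ), F ↑(g • z) = F ↑z) {z : ℂ}
    (hz : 0 < z.im) : F (z + 1) = F z := by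
  have := hinv ModularGroup.T ⟨z, hz⟩
  rw [UpperHalfPlane.modular_T_smul, UpperHalfPlane.coe_vadd] at this
  simpa [add_comm] using this

/-! ### The partition function `D = incEis ψ` -/

/-- Summability of the bump-seeded incomplete Eisenstein series (finitely many nonzero terms).
[folklore] -/
theorem summable_incEisTerm_bump {z : ℂ} (hz : 0 < z.im) :
    Summable fun v : coprimePairs =>
      incEisTerm (fun t : ℝ => Real.smoothTransition (3 * (t - 1 / 2))) v.1 z := by
  obtain ⟨N, hN₀, hN₁⟩ := exists_pairBox_bound (1 / 2) z.im |z.re| z.im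
  classical
  refine summable_of_ne_finset_zero (s := coprimePairBox N) fun v hv => ?_
  apply incEisTerm_eq_zero_of_not_mem_pairBox (a := 1 / 2) (by norm_num) bump_support hz hN₀ hN₁
    le_rfl le_rfl le_rfl
  simpa [coprimePairBox, Finset.mem_subtype] using hv

/-- On the fundamental domain `im ≥ √3/2 > 5/6`, so the term of `(0, 1)` alone gives `D ≥ 1`.
[folklore] -/
theorem one_le_tsum_incEisTerm_bump {w : ℍ} (hw : w ∈ ModularGroup.fd) :
    1 ≤ ∑' v : coprimePairs,
      incEisTerm (fun t : ℝ => Real.smoothTransition (3 * (t - 1 / 2))) v.1 (w : ℂ) := by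
  have him : 5 / 6 ≤ w.im := by
    obtain ⟨h1, h2⟩ := hw
    rw [Complex.normSq_apply, UpperHalfPlane.coe_re, UpperHalfPlane.coe_im] at h1
    have hre : w.re * w.re ≤ 1 / 4 := by
      have := abs_le.mp h2; nlinarith
    nlinarith [w.im_pos]
  let v₀ : coprimePairs := ⟨![0, 1], (EisensteinSeries.mem_gammaSet_one _).mpr (by
    simpa using isCoprime_zero_left.mpr isUnit_one)⟩
  have hv₀ : incEisTerm (fun t : ℝ => Real.smoothTransition (3 * (t - 1 / 2))) v₀.1 (w : ℂ) = 1 := by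
    simp only [incEisTerm, v₀]
    norm_num
    linarith
  calc (1 : ℝ) = incEisTerm (fun t : ℝ => Real.smoothTransition (3 * (t - 1 / 2))) v₀.1 (w : ℂ) :=
        hv₀.symm
    _ ≤ _ := (summable_incEisTerm_bump w.im_pos).le_tsum v₀ fun v _ =>
        Real.smoothTransition.nonneg _

/-- `D(z) ≠ 0` on `ℍ` (move `z` to the fundamental domain by `SL(2,ℤ)`-invariance of `D`).
[folklore] -/
theorem incEis_bump_ne_zero (z : ℍ) :
    incEis (fun t : ℝ => Real.smoothTransition (3 * (t - 1 / 2))) (z : ℂ) ≠ 0 := by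
  obtain ⟨g, hg⟩ := ModularGroup.exists_smul_mem_fd z
  rw [← incEis_smul _ g z]
  have h1 := one_le_tsum_incEisTerm_bump hg
  unfold incEis
  intro h
  have h' := congrArg Complex.re h
  rw [Complex.ofReal_re, Complex.zero_re] at h'
  linarith

/-! ### The strip test `f = F · ψ(im) / D` -/

variable {f : ℂ → ℂ}

/-- **Smoothness of `f` on all of `ℂ`**: on `{im > 0}` it is a quotient of smooth functions with
nonvanishing denominator, and it vanishes identically on `{im < 1/2}`. [folklore] -/
theorem strip_contDiff (hF : ContDiffOn ℝ ∞ F {z : ℂ | 0 < z.im})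
    (hfdef : ∀ z, f z = F z * ((Real.smoothTransition (3 * (z.im - 1 / 2)) : ℝ) : ℂ) /
      incEis (fun t : ℝ => Real.smoothTransition (3 * (t - 1 / 2))) z) :
    ContDiff ℝ ∞ f := by
  rw [show f = fun z => F z * ((Real.smoothTransition (3 * (z.im - 1 / 2)) : ℝ) : ℂ) *
      (incEis (fun t : ℝ => Real.smoothTransition (3 * (t - 1 / 2))) z)⁻¹ from
    funext fun z => by rw [hfdef, div_eq_mul_inv]]
  refine contDiff_iff_contDiffAt.2 fun z => ?_
  by_cases hz : 0 < z.im
  · have hopen : IsOpen {z : ℂ | 0 < z.im} := isOpen_lt continuous_const Complex.continuous_im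
    have h1 : ContDiffOn ℝ ∞ (fun z : ℂ => F z *
        ((Real.smoothTransition (3 * (z.im - 1 / 2)) : ℝ) : ℂ) *
          (incEis (fun t : ℝ => Real.smoothTransition (3 * (t - 1 / 2))) z)⁻¹) {z : ℂ | 0 < z.im} := by
      refine (hF.mul ?_).mul ((contDiffOn_incEis (by norm_num) bump_support bump_contDiff).inv
        fun w hw => incEis_bump_ne_zero ⟨w, hw⟩)
      exact (Complex.ofRealCLM.contDiff.comp
        (bump_contDiff.comp Complex.imCLM.contDiff)).contDiffOn
    exact (h1 z hz).contDiffAt (hopen.mem_nhds hz)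
  · have hU : {w : ℂ | w.im < 1 / 2} ∈ 𝓝 z :=
      (isOpen_lt Complex.continuous_im continuous_const).mem_nhds (by
        simp only [Set.mem_setOf_eq]; linarith [not_lt.mp hz])
    refine (contDiffAt_const (c := (0:ℂ))).congr_of_eventuallyEq ?_
    filter_upwards [hU] with w hw
    rw [bump_eq_zero hw.le]
    simp

/-- `f` is `1`-periodic. [folklore] -/
theorem strip_periodic (hinv : ∀ (g : SL(2, ℤ)) (z : ℍ), F ↑(g • z) = F ↑z)
    (hfdef : ∀ z, f z = F z * ((Real.smoothTransition (3 * (z.im - 1 / 2)) : ℝ) : ℂ) /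
      incEis (fun t : ℝ => Real.smoothTransition (3 * (t - 1 / 2))) z) (z : ℂ) :
    f (z + 1) = f z := by
  rw [hfdef, hfdef]
  by_cases hz : 0 < z.im
  · have h1 : F (z + 1) = F z := apply_add_one hinv hz
    have h2 : incEis (fun t : ℝ => Real.smoothTransition (3 * (t - 1 / 2))) (z + 1) =
        incEis (fun t : ℝ => Real.smoothTransition (3 * (t - 1 / 2))) z := by
      have := incEis_smul (fun t : ℝ => Real.smoothTransition (3 * (t - 1 / 2))) ModularGroup.T ⟨z, hz⟩
      rw [UpperHalfPlane.modular_T_smul, UpperHalfPlane.coe_vadd] at this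
      simpa [add_comm] using this
    simp only [add_im, one_im, add_zero, h1, h2]
  · have : z.im ≤ 1 / 2 := by linarith [not_lt.mp hz]
    simp only [add_im, one_im, add_zero, bump_eq_zero this]
    simp

/-- `f` is supported in the strip `1/2 ≤ im z ≤ max Y 1`. [folklore] -/
theorem strip_support (hinv : ∀ (g : SL(2, ℤ)) (z : ℍ), F ↑(g • z) = F ↑z)
    (hY : ∀ z : ℍ, z ∈ ModularGroup.fd → Y < z.im → F ↑z = 0)
    (hfdef : ∀ z, f z = F z * ((Real.smoothTransition (3 * (z.im - 1 / 2)) : ℝ) : ℂ) /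
      incEis (fun t : ℝ => Real.smoothTransition (3 * (t - 1 / 2))) z) (z : ℂ) (h : f z ≠ 0) :
    1 / 2 ≤ z.im ∧ z.im ≤ max Y 1 := by
  rw [hfdef] at h
  have hb : Real.smoothTransition (3 * (z.im - 1 / 2)) ≠ 0 := by
    intro h0; rw [h0] at h; simp at h
  have h1 : 1 / 2 ≤ z.im := bump_support _ hb
  refine ⟨h1, ?_⟩
  by_contra hlt
  have : F z = 0 := apply_eq_zero_of_lt_im hinv hY (by linarith) (not_le.mp hlt)
  rw [this] at h; simp at h

/-- **The incomplete Poincaré series of `f` is `F`**: for `z ∈ ℍ`,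
`∑_{(c,d)=1} T_f((c,d), z) = F(z)`, since `T_f(v, z) = F(z) ψ(im z/|cz+d|²)/D(z)` (invariance of
`F` and `D`, `im(γ_v z) = im z/|cz+d|²`) and `∑_v ψ(im z/|cz+d|²) = D(z)`. [folklore] -/
theorem tsum_summand_eq (hinv : ∀ (g : SL(2, ℤ)) (z : ℍ), F ↑(g • z) = F ↑z)
    (hfdef : ∀ z, f z = F z * ((Real.smoothTransition (3 * (z.im - 1 / 2)) : ℝ) : ℂ) /
      incEis (fun t : ℝ => Real.smoothTransition (3 * (t - 1 / 2))) z) (z : ℍ) :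
    (∑' v : coprimePairs, (if v.1 0 = 0 then f z else
      f (((Int.gcdA (v.1 1) (v.1 0) : ℂ) * z - (Int.gcdB (v.1 1) (v.1 0) : ℂ)) /
        ((v.1 0 : ℂ) * z + v.1 1)))) = F z := by
  have hD := incEis_bump_ne_zero z
  have hterm : ∀ v : coprimePairs, (if v.1 0 = 0 then f z else
      f (((Int.gcdA (v.1 1) (v.1 0) : ℂ) * z - (Int.gcdB (v.1 1) (v.1 0) : ℂ)) /
        ((v.1 0 : ℂ) * z + v.1 1))) =
      (F z / incEis (fun t : ℝ => Real.smoothTransition (3 * (t - 1 / 2))) (z : ℂ)) *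
        (incEisTerm (fun t : ℝ => Real.smoothTransition (3 * (t - 1 / 2))) v.1 z : ℂ) := by
    intro v
    have hcop := (EisensteinSeries.mem_gammaSet_one _).mp v.2
    split_ifs with h0
    · have hu : IsUnit (v.1 1) := by rw [h0] at hcop; exact isCoprime_zero_left.mp hcop
      have h1 : Complex.normSq ((v.1 0 : ℂ) * z + v.1 1) = 1 := by
        rcases Int.isUnit_iff.mp hu with h1 | h1 <;> simp [h0, h1]
      rw [hfdef, incEisTerm, h1, div_one, UpperHalfPlane.coe_im]
      ring
    · obtain ⟨g, hg0, hg1⟩ := hcop.exists_SL2_row 1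
      have hc : g 1 0 ≠ 0 := by rw [hg0]; exact h0
      have e1 := apply_smul_eq (f := f) (strip_periodic hinv hfdef) g hc z
      rw [hg0, hg1] at e1
      rw [← e1, hfdef, hinv g z, incEis_smul _ g z, UpperHalfPlane.coe_im, im_smul_eq g z, hg0, hg1,
        incEisTerm, UpperHalfPlane.coe_im]
      ring
  rw [tsum_congr hterm, tsum_mul_left]
  have hsum : (∑' v : coprimePairs,
      (incEisTerm (fun t : ℝ => Real.smoothTransition (3 * (t - 1 / 2))) v.1 (z : ℂ) : ℂ)) =
      incEis (fun t : ℝ => Real.smoothTransition (3 * (t - 1 / 2))) (z : ℂ) := by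
    unfold incEis
    rw [Complex.ofReal_tsum]
  rw [hsum, div_mul_cancel₀ _ hD]


/-! ### The rate `O(y^{1/2})` -/

open scoped ArithmeticFunction.Moebius in
/-- **Main estimate.** For `F` smooth on `ℍ`, `SL(2,ℤ)`-invariant and vanishing on the
fundamental domain above height `Y`, the horocycle averages satisfy
`∫₀¹ F(x+iy) dx = c + O(y^{1/2})` as `y → 0⁺`, with
`c = 2 (∑_d μ(d)/d²) ∫₀³ K`, `K` the zero-mode kernel of the strip test `f = Fψ(im)/D`
(unfolding `horocycleAverage_poincare`, nonzero modes by `norm_sum_coprime_sub_le` and the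
uniform decay `exists_norm_coeffPsi_le` over the `≤ √(2/y)` rows with `c²y < 2`, zero mode by
`zeroMode_bound`). [cite: Sarnak1981, Thm 1] -/
theorem isBigO_horocycleAverage (hF : ContDiffOn ℝ ∞ F {z : ℂ | 0 < z.im})
    (hinv : ∀ (g : SL(2, ℤ)) (z : ℍ), F ↑(g • z) = F ↑z)
    (hY : ∀ z : ℍ, z ∈ ModularGroup.fd → Y < z.im → F ↑z = 0) :
    ∃ c : ℂ, Asymptotics.IsBigO (𝓝[>] (0 : ℝ))
      (fun y : ℝ => (∫ x in (0 : ℝ)..1, F (↑x + ↑y * Complex.I)) - c)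
      (fun y : ℝ => y ^ ((1 / 2 : ℝ))) := by
  -- the strip test `f = F ψ(im) / D`
  set f : ℂ → ℂ := fun z => F z * ((Real.smoothTransition (3 * (z.im - 1 / 2)) : ℝ) : ℂ) /
    incEis (fun t : ℝ => Real.smoothTransition (3 * (t - 1 / 2))) z with hf_def
  have hfdef : ∀ z, f z = F z * ((Real.smoothTransition (3 * (z.im - 1 / 2)) : ℝ) : ℂ) /
      incEis (fun t : ℝ => Real.smoothTransition (3 * (t - 1 / 2))) z := fun z => rfl
  have ha : (0 : ℝ) < 1 / 2 := by norm_num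
  have hab : (1 / 2 : ℝ) ≤ max Y 1 := le_trans (by norm_num) (le_max_right _ _)
  have hfC : ContDiff ℝ ∞ f := strip_contDiff hF hfdef
  have hper : ∀ z, f (z + 1) = f z := strip_periodic hinv hfdef
  have hsupp : ∀ z, f z ≠ 0 → 1 / 2 ≤ z.im ∧ z.im ≤ max Y 1 := strip_support hinv hY hfdef
  have hfc : Continuous f := hfC.continuous
  -- the constants: decay of the nonzero modes, the zero-mode kernel and its bound
  obtain ⟨M, hM0, hM⟩ := exists_norm_coeffPsi_le hfC hper hsupp ha hab
  set K : ℝ → ℂ := fun l => ∫ s in (-(1 + 1 / (1 / 2 : ℝ)))..(1 + 1 / (1 / 2 : ℝ)),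
    ∫ x in (0:ℝ)..1, f (x + (1 / (l ^ 2 + s ^ 2) : ℝ) * I) with hK_def
  have hKC : ContDiff ℝ 2 K := (contDiff_zeroKernel hfC hsupp ha hab _).of_le (by norm_cast)
  have hR : (0 : ℝ) < 1 + 1 / (1 / 2 : ℝ) := by norm_num
  have hKR : ∀ s, 1 + 1 / (1 / 2 : ℝ) ≤ s → K s = 0 := fun s hs => zeroKernel_eq_zero hfc hsupp ha _ hs
  obtain ⟨C₀, hC₀⟩ := HorocycleZeroMode.zeroMode_bound hKC hR hKR
  set S : ℂ := ∑' d : ℕ, (μ d : ℂ) / (d : ℂ) ^ 2 with hS_def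
  set Iint : ℂ := ∫ s in (0:ℝ)..(1 + 1 / (1 / 2 : ℝ)), K s with hI_def
  refine ⟨2 * (S * Iint), ?_⟩
  refine Asymptotics.IsBigO.of_bound (2 * C₀ + 16 * Real.sqrt 2 * M) ?_
  have hmem : Set.Ioo (0 : ℝ) (1 / 4) ∈ 𝓝[>] (0 : ℝ) := Ioo_mem_nhdsGT (by norm_num)
  filter_upwards [hmem] with y hy
  obtain ⟨hy0, hy4⟩ := hy
  have hsy : 0 < Real.sqrt y := Real.sqrt_pos.mpr hy0
  have hsy2 : Real.sqrt y * Real.sqrt y = y := Real.mul_self_sqrt hy0.le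
  -- the cut-off `N`
  obtain ⟨N, hN⟩ : ∃ N : ℕ, 1 / (1 / 2 * y) * 1 + Real.sqrt (y / (1 / 2)) +
      (1 + 1 / (1 / 2 : ℝ)) / Real.sqrt y ≤ N := ⟨_, Nat.le_ceil _⟩
  have hN₀ : 1 / (1 / 2 * y) ≤ N := by
    have h1 : 0 ≤ Real.sqrt (y / (1 / 2)) := Real.sqrt_nonneg _
    have h2 : 0 ≤ (1 + 1 / (1 / 2 : ℝ)) / Real.sqrt y := by positivity
    linarith
  have hN₁ : 1 / (1 / 2 * y) * 1 + Real.sqrt (y / (1 / 2)) ≤ N := by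
    have h2 : 0 ≤ (1 + 1 / (1 / 2 : ℝ)) / Real.sqrt y := by positivity
    linarith
  have hNR : 1 + 1 / (1 / 2 : ℝ) ≤ Real.sqrt y * N := by
    have h1 : (1 + 1 / (1 / 2 : ℝ)) / Real.sqrt y ≤ N := by
      have : 0 ≤ 1 / (1 / 2 * y) * 1 + Real.sqrt (y / (1 / 2)) := by positivity
      linarith
    rwa [div_le_iff₀ hsy, mul_comm] at h1
  -- Step 1: `F = P_f` on the segment, then unfold
  set Ψ' : ℕ → ℝ → ℂ := fun c θ => ∫ t : ℝ, f ((θ : ℂ) -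
    1 / (((((c : ℝ) ^ 2 * y : ℝ)) : ℂ) * ((t : ℂ) + I))) with hΨ'_def
  have hunf : ∫ x in (0 : ℝ)..1, F (↑x + ↑y * Complex.I) =
      (2 * ∫ x in (0:ℝ)..1, f ((x : ℂ) + y * I)) +
        2 * ∑ c ∈ Finset.Ioc 0 N, (y : ℂ) *
          ∑ r ∈ (Finset.range c).filter (fun r => Nat.Coprime c r), Ψ' c ((r : ℝ) / c) := by
    rw [← horocycleAverage_poincare hfc hper hsupp ha hy0 hN₀ hN₁]
    refine intervalIntegral.integral_congr fun x _ => ?_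
    have hz : 0 < ((x : ℂ) + y * I).im := by simpa using hy0
    exact (tsum_summand_eq hinv hfdef ⟨(x : ℂ) + y * I, hz⟩).symm
  -- Step 2: the seed term vanishes at height `y < 1/2`
  have hseed : ∫ x in (0:ℝ)..1, f ((x : ℂ) + y * I) = 0 := by
    apply horizontalAverage_eq_zero hfc hsupp
    rintro ⟨h1, -⟩; linarith
  -- Step 3: each row: nonzero modes are `O(1)`, and vanish for `c² y ≥ 2`
  set coef : ℕ → ℤ → ℂ := fun c k => ∫ θ in (0:ℝ)..1, Ψ' c θ *
    Complex.exp (-(2 * π * I * k * θ)) with hcoef_def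
  set E : ℕ → ℂ := fun c => (∑ r ∈ (Finset.range c).filter (fun r => Nat.Coprime c r),
    Ψ' c ((r : ℝ) / c)) - (Nat.totient c : ℂ) * coef c 0 with hE_def
  have hEle : ∀ c ∈ Finset.Ioc 0 N, ‖E c‖ ≤ 8 * M := by
    intro c hc
    rw [Finset.mem_Ioc] at hc
    have hcpos : (0:ℝ) < c := by exact_mod_cast hc.1
    have hw : 0 < (c : ℝ) ^ 2 * y := by positivity
    exact CoprimeResidueSums.norm_sum_coprime_sub_le (h := Ψ' c) (b := coef c)
      (hasSum_integral_apply_hpt hfC hper hsupp ha hab hw)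
      (summable_coeffPsi hfC hper hsupp ha hab hw) (fun k hk => hM _ hw k hk) hc.1
  have hE0 : ∀ c ∈ Finset.Ioc 0 N, 2 ≤ (c : ℝ) ^ 2 * y → E c = 0 := by
    intro c _ hcy
    have hzero : ∀ θ, Ψ' c θ = 0 := fun θ =>
      integral_apply_hpt_eq_zero_of_le hfc hsupp ha (by norm_num; linarith) θ
    simp only [hE_def, hcoef_def, hzero]
    simp
  -- Step 4: the zero mode of row `c` is `√y (φ(c)/c) K(√y c)`
  have hzero_mode : ∀ c ∈ Finset.Ioc 0 N,
      (y : ℂ) * ((Nat.totient c : ℂ) * coef c 0) =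
        (Real.sqrt y : ℂ) * (((Nat.totient c : ℂ) / c) * K (Real.sqrt y * c)) := by
    intro c hc
    rw [Finset.mem_Ioc] at hc
    have hc0 : (0 : ℝ) < c := by exact_mod_cast hc.1
    have hcC : (c : ℂ) ≠ 0 := by exact_mod_cast (show (c:ℕ) ≠ 0 by omega)
    have hl : 0 < (c : ℝ) * Real.sqrt y := by positivity
    have key := mul_coeffPsi_zero_eq hfc hper hsupp ha hl
    have hw : ((c : ℝ) * Real.sqrt y) ^ 2 = (c : ℝ) ^ 2 * y := by
      rw [mul_pow, Real.sq_sqrt hy0.le]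
    have hcoef : coef c 0 = ∫ θ in (0:ℝ)..1, (∫ t : ℝ, f ((θ : ℂ) -
        1 / (((((c : ℝ) * Real.sqrt y) ^ 2 : ℝ) : ℂ) * ((t : ℂ) + I)))) *
          Complex.exp (-(2 * π * I * ((0:ℤ) : ℂ) * θ)) := by
      rw [hw]
    -- `key : ↑(c √y) * (∫₀¹ Ψ((c√y)², θ) dθ) = K (c √y)`
    have hK : K (Real.sqrt y * c) = (((c : ℝ) * Real.sqrt y : ℝ) : ℂ) * coef c 0 := by
      rw [hcoef, key, mul_comm (Real.sqrt y) c]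
    rw [hK]
    have hy' : (y : ℂ) = (Real.sqrt y : ℂ) * (Real.sqrt y : ℂ) := by
      rw [← Complex.ofReal_mul, hsy2]
    rw [hy']
    push_cast
    field_simp
  -- Step 5: split the row sum into zero mode + error
  have hsplit : ∑ c ∈ Finset.Ioc 0 N, (y : ℂ) *
      ∑ r ∈ (Finset.range c).filter (fun r => Nat.Coprime c r), Ψ' c ((r : ℝ) / c) =
      (y : ℂ) * ∑ c ∈ Finset.Ioc 0 N, E c +
        (Real.sqrt y : ℂ) * ∑ c ∈ Finset.Ioc 0 N, ((Nat.totient c : ℂ) / c) * K (Real.sqrt y * c) := by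
    rw [Finset.mul_sum, Finset.mul_sum, ← Finset.sum_add_distrib]
    refine Finset.sum_congr rfl fun c hc => ?_
    rw [← hzero_mode c hc]
    simp only [hE_def]
    ring
  -- Step 6: the error rows: only `c² y < 2` contribute, at most `√(2/y)` of them
  have hEsum : ‖∑ c ∈ Finset.Ioc 0 N, E c‖ ≤ 8 * M * Real.sqrt (2 / y) := by
    have h1 : ∑ c ∈ Finset.Ioc 0 N, ‖E c‖ =
        ∑ c ∈ (Finset.Ioc 0 N).filter (fun c : ℕ => (c : ℝ) ^ 2 * y < 2), ‖E c‖ := by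
      rw [Finset.sum_filter]
      refine Finset.sum_congr rfl fun c hc => ?_
      split_ifs with h
      · rfl
      · rw [hE0 c hc (not_lt.mp h), norm_zero]
    have h2 : ((Finset.Ioc 0 N).filter (fun c : ℕ => (c : ℝ) ^ 2 * y < 2)).card ≤
        ⌊Real.sqrt (2 / y)⌋₊ := by
      calc ((Finset.Ioc 0 N).filter (fun c : ℕ => (c : ℝ) ^ 2 * y < 2)).card
          ≤ (Finset.Ioc 0 ⌊Real.sqrt (2 / y)⌋₊).card := by
            apply Finset.card_le_card
            intro c hc
            rw [Finset.mem_filter, Finset.mem_Ioc] at hc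
            rw [Finset.mem_Ioc]
            refine ⟨hc.1.1, Nat.le_floor ?_⟩
            refine le_trans (le_abs_self _) (Real.abs_le_sqrt ?_)
            rw [le_div_iff₀ hy0]
            exact hc.2.le
        _ = ⌊Real.sqrt (2 / y)⌋₊ := by simp
    calc ‖∑ c ∈ Finset.Ioc 0 N, E c‖ ≤ ∑ c ∈ Finset.Ioc 0 N, ‖E c‖ := norm_sum_le _ _
      _ = ∑ c ∈ (Finset.Ioc 0 N).filter (fun c : ℕ => (c : ℝ) ^ 2 * y < 2), ‖E c‖ := h1
      _ ≤ ∑ c ∈ (Finset.Ioc 0 N).filter (fun c : ℕ => (c : ℝ) ^ 2 * y < 2), 8 * M :=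
          Finset.sum_le_sum fun c hc => hEle c (Finset.mem_filter.mp hc).1
      _ = ((Finset.Ioc 0 N).filter (fun c : ℕ => (c : ℝ) ^ 2 * y < 2)).card * (8 * M) := by
          rw [Finset.sum_const, nsmul_eq_mul]
      _ ≤ ⌊Real.sqrt (2 / y)⌋₊ * (8 * M) := by gcongr
      _ ≤ Real.sqrt (2 / y) * (8 * M) := by gcongr; exact Nat.floor_le (Real.sqrt_nonneg _)
      _ = 8 * M * Real.sqrt (2 / y) := by ring
  -- Step 7: the zero mode
  have hZ := hC₀ (Real.sqrt y) hsy N hNR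
  -- Step 8: assemble
  have hsqrt2y : y * Real.sqrt (2 / y) = Real.sqrt 2 * Real.sqrt y := by
    rw [Real.sqrt_div' 2 hy0.le, mul_div_assoc', mul_comm y, mul_div_assoc, Real.div_sqrt]
  have hnorm_y : ‖(fun y : ℝ => y ^ ((1 / 2 : ℝ))) y‖ = Real.sqrt y := by
    simp only [Real.norm_of_nonneg (Real.rpow_nonneg hy0.le _), Real.sqrt_eq_rpow]
  rw [hnorm_y]
  change ‖(∫ x in (0 : ℝ)..1, F (↑x + ↑y * Complex.I)) - 2 * (S * Iint)‖ ≤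
    (2 * C₀ + 16 * Real.sqrt 2 * M) * Real.sqrt y
  rw [hunf, hseed, mul_zero, zero_add, hsplit]
  have e : 2 * ((y : ℂ) * ∑ c ∈ Finset.Ioc 0 N, E c +
      (Real.sqrt y : ℂ) * ∑ c ∈ Finset.Ioc 0 N, ((Nat.totient c : ℂ) / c) * K (Real.sqrt y * c)) -
      2 * (S * Iint) =
      2 * ((y : ℂ) * ∑ c ∈ Finset.Ioc 0 N, E c) +
        2 * (Real.sqrt y : ℂ) * (∑ c ∈ Finset.Ioc 0 N, ((Nat.totient c : ℂ) / c) * K (Real.sqrt y * c) -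
          S * Iint / (Real.sqrt y : ℂ)) := by
    have : (Real.sqrt y : ℂ) ≠ 0 := by exact_mod_cast hsy.ne'
    field_simp
    ring
  rw [e]
  refine (norm_add_le _ _).trans ?_
  have hA : ‖2 * ((y : ℂ) * ∑ c ∈ Finset.Ioc 0 N, E c)‖ ≤ 16 * Real.sqrt 2 * M * Real.sqrt y := by
    rw [norm_mul, norm_mul, Complex.norm_real, Real.norm_of_nonneg hy0.le]
    have : ‖(2 : ℂ)‖ = 2 := by simp
    rw [this]
    calc 2 * (y * ‖∑ c ∈ Finset.Ioc 0 N, E c‖) ≤ 2 * (y * (8 * M * Real.sqrt (2 / y))) := by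
          gcongr
      _ = 16 * M * (y * Real.sqrt (2 / y)) := by ring
      _ = 16 * Real.sqrt 2 * M * Real.sqrt y := by rw [hsqrt2y]; ring
  have hB : ‖2 * (Real.sqrt y : ℂ) * (∑ c ∈ Finset.Ioc 0 N, ((Nat.totient c : ℂ) / c) *
      K (Real.sqrt y * c) - S * Iint / (Real.sqrt y : ℂ))‖ ≤ 2 * Real.sqrt y * C₀ := by
    rw [norm_mul, norm_mul, Complex.norm_real, Real.norm_of_nonneg hsy.le]
    have : ‖(2 : ℂ)‖ = 2 := by simp
    rw [this]
    gcongr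
  calc _ ≤ 16 * Real.sqrt 2 * M * Real.sqrt y + 2 * Real.sqrt y * C₀ := add_le_add hA hB
    _ = (2 * C₀ + 16 * Real.sqrt 2 * M) * Real.sqrt y := by ring

end HorocycleRateHalf

/-- **Discharge of `zagier_sarnak_horocycle_rate_half`** (Sarnak 1981, Thm. 1; Zagier 1981, §1):
the unconditional rate `O(y^{1/2})` for horocycle averages of smooth compactly supported
functions on `SL(2,ℤ)\ℍ`, by the elementary unfolding proof
(`HorocycleRateHalf.isBigO_horocycleAverage`). [cite: Sarnak1981, Thm 1] -/
theorem zagier_sarnak_horocycle_rate_half_holds : zagier_sarnak_horocycle_rate_half :=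
  fun _ hF hinv ⟨_, hY⟩ => HorocycleRateHalf.isBigO_horocycleAverage hF hinv hY

end Literature.NumberTheory.LFunctions

end
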